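import Summits.CriticalPhenomena.CardyFormulaZ2.Theses.CardySelfDualSegment
import Summits.CriticalPhenomena.CardyFormulaZ2.Theorems.RectilinearCardy.Negative.RectilinearCardySquareInstance
import Literature.Barriers.CriticalPhenomena.EmbeddingModulusUniquenessProofs

/-!
# `SegmentClosed` (crux stmt-CriticalPhenomena-5473): load-bearing anatomy of the identification stub

Negative-knowledge lemmas from the standing disprover's work file `Cruxes/SegmentClosed/Disproof.lean`
(refuter `cdisprove`, 2026-08-16), sorry-free. They concern the stub `stub_identification` of the picked
line `Sketch` (`Cruxes/SegmentClosed/Lines/Sketch.lean`): for an ABSTRACT family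
`P : unitInterval → ConformalRectangle → ℝ → ℝ`, if `CardyMod (t n) (α n)` holds along `t n → t₀`,
`α n → α₀ ∈ ℍ`, and `P` is equicontinuous in the parameter at `t₀` uniformly in the mesh (UM), then
`CardyMod t₀ α₀`. Which hypotheses carry weight:

* `stub_identification_false_without_UM` — deleting uniform marginality makes the stub FALSE
  (witness: `α ≡ i`, `t n = 1/(n+1) → 0`, `P s R δ = F(η(R))` for `s ≠ 0` and `P 0 R δ = 2`).
* `stub_identification_false_without_tendsto` — deleting `t n → t₀` makes it FALSE
  (witness: `t ≡ 1`, `t₀ = 0`, `P s = 2` for `s < 1/2`, `= F(η(R))` for `s ≥ 1/2`; UM holds at `0`).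
* `stub_identification_false_without_hmod` — deleting the Cardy hypothesis along the sequence makes it
  FALSE (witness `P ≡ 2`).
* `cardyMod_of_im_eq_zero` — by contrast `hα₀ : 0 < im α₀` (and a fortiori `hαn`) is NOT needed for
  truth: for real `α₀` the shear `φ_{α₀}` collapses `ℂ` onto `ℝ`, no conformal rectangle has carrier
  `φ_{α₀}(R')`, and `CardyMod t₀ α₀` holds vacuously; `hα₀` only serves the composition
  (`segmentClosed_of_stubs` needs `α₀ ∈ ℍ` as the witness for `t₀ ∈ G`).

Tools: `exists_isUniformizing_of_carrier_eq` / `modulus_eq_of_carrier_eq` (uniformizing data and the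
modulus only see the carrier and the marked points, not the boundary parametrisation — the transfer
used implicitly by the stub when it passes from the given `R` to `R'.map (shearHomeomorph α₀)`). No
definitions are declared in this file.

References: V. Beffara, *Is critical 2D percolation universal?* (2008) [Beffara2008Universal];
Ch. Pommerenke, *Boundary Behaviour of Conformal Maps* (1992), §2.3 [PommerenkeBBCM1992].
-/

noncomputable section

namespace Summit.CriticalPhenomena.CardyFormulaZ2.Theorems.SegmentClosed.Negative

open Set Filter Topology Complex Metric
open UpperHalfPlane (upperHalfPlaneSet)
open Literature.Probability.RandomPlanarGeometry
open Literature.Probability.Percolation (unitSquareQuad unitSquareQuad_carrier)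
open Literature.Barriers.CriticalPhenomena
open Summit.CriticalPhenomena.CardyFormulaZ2.Theorems.RectilinearCardy.Negative (modulus
  isUniformizing_modulusDatum crossRatio_eq_modulus crossRatio_unitSquareQuad cardyFunction_half)

/-! ## §1 Uniformizing data only see the carrier and the marked points -/

/-- **Two conformal rectangles with the same carrier and the same marked points have the same
uniformizing data** (transport the conformal equivalence along the equality of targets: same
underlying partial equivalence, same boundary values). [folklore] -/
theorem exists_isUniformizing_of_carrier_eq {R R' : ConformalRectangle} (hc : R.carrier = R'.carrier)
    (hp : ∀ i, R.pt i = R'.pt i) {φ : ConformalEquiv upperHalfPlaneSet R.carrier} {x : Fin 4 → ℝ}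
    (h : R.IsUniformizing φ x) :
    ∃ φ' : ConformalEquiv upperHalfPlaneSet R'.carrier, R'.IsUniformizing φ' x :=
  ⟨{ toPartialEquiv := φ.toPartialEquiv
     source_eq := φ.source_eq
     target_eq := φ.target_eq.trans hc
     differentiableOn := φ.differentiableOn
     differentiableOn_symm := hc ▸ φ.differentiableOn_symm },
    h.1, fun i => by rw [← hp i]; exact h.2 i⟩

/-- … hence the same cross-ratio for all their uniformizing data, and the same modulus. [folklore] -/
theorem crossRatio_eq_modulus_of_carrier_eq {R R' : ConformalRectangle} (hc : R.carrier = R'.carrier)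
    (hp : ∀ i, R.pt i = R'.pt i) {φ : ConformalEquiv upperHalfPlaneSet R.carrier} {x : Fin 4 → ℝ}
    (h : R.IsUniformizing φ x) : crossRatio x = modulus R' := by
  obtain ⟨φ', h'⟩ := exists_isUniformizing_of_carrier_eq hc hp h
  exact crossRatio_eq_modulus h'

/-- Same carrier and marked points ⇒ same conformal modulus. [folklore] -/
theorem modulus_eq_of_carrier_eq {R R' : ConformalRectangle} (hc : R.carrier = R'.carrier)
    (hp : ∀ i, R.pt i = R'.pt i) : modulus R = modulus R' := by
  rw [← crossRatio_eq_modulus (isUniformizing_modulusDatum R),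
    crossRatio_eq_modulus_of_carrier_eq hc hp (isUniformizing_modulusDatum R)]

/-- `φ_i = id` on carriers: `R.carrier = φ_i(R'.carrier)` means `R.carrier = R'.carrier`. [folklore] -/
theorem moduliShear_I_image (S : Set ℂ) : moduliShear I '' S = S := by
  rw [show moduliShear I = id from funext moduliShear_I_apply, Set.image_id]

/-! ## §2 The three load-bearing hypotheses of `stub_identification` -/

/-- The sequence `t n = 1/(n+1)` in `[0,1]`. [folklore] -/
theorem one_div_succ_mem_unitInterval (n : ℕ) : 1 / ((n : ℝ) + 1) ∈ Set.Icc (0 : ℝ) 1 := by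
  refine ⟨by positivity, ?_⟩
  rw [div_le_one (by positivity)]
  linarith [n.cast_nonneg (α := ℝ)]

/-- **`stub_identification` WITHOUT uniform marginality is FALSE.** Witness: `α ≡ i` (so the sheared
rectangle is the rectangle itself), `t n = 1/(n+1) → t₀ = 0`, and the abstract family
`P s R δ = F(η(R))` for `s ≠ 0`, `P 0 R δ = 2`: the Cardy hypothesis holds at every `t n`, but at
`t₀ = 0` the crossing "probabilities" of the unit square tend to `2 ≠ F(1/2) = 1/2`. So the `3ε`
exchange through UM is genuinely used. [folklore] -/
theorem stub_identification_false_without_UM :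
    ¬ ∀ (P : unitInterval → ConformalRectangle → ℝ → ℝ) (t : ℕ → unitInterval) (t₀ : unitInterval)
        (α : ℕ → ℂ) (α₀ : ℂ),
        Tendsto t atTop (𝓝 t₀) → Tendsto α atTop (𝓝 α₀) → (∀ n, 0 < (α n).im) → 0 < α₀.im →
        (∀ n (R R' : ConformalRectangle) (φ : ConformalEquiv upperHalfPlaneSet R.carrier)
          (x : Fin 4 → ℝ), R.carrier = moduliShear (α n) '' R'.carrier →
          (∀ i, R.pt i = moduliShear (α n) (R'.pt i)) → R.IsUniformizing φ x →
          Tendsto (P (t n) R') (𝓝[>] 0) (𝓝 (cardyFunction (crossRatio x)))) →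
        ∀ (R R' : ConformalRectangle) (φ : ConformalEquiv upperHalfPlaneSet R.carrier)
          (x : Fin 4 → ℝ), R.carrier = moduliShear α₀ '' R'.carrier →
          (∀ i, R.pt i = moduliShear α₀ (R'.pt i)) → R.IsUniformizing φ x →
          Tendsto (P t₀ R') (𝓝[>] 0) (𝓝 (cardyFunction (crossRatio x))) := by
  intro H
  obtain ⟨φ₀, x₀, hux₀⟩ := MarkedDomain.exists_isUniformizing_holds unitSquareQuad
  have hne : ∀ n : ℕ, (⟨1 / ((n : ℝ) + 1), one_div_succ_mem_unitInterval n⟩ : unitInterval) ≠ 0 := by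
    intro n h
    have h' := congrArg Subtype.val h
    have hpos : (0 : ℝ) < 1 / ((n : ℝ) + 1) := by positivity
    simp only [Set.Icc.coe_zero] at h'
    linarith
  have key := H (fun s R _ => if s = 0 then 2 else cardyFunction (modulus R))
    (fun n => ⟨1 / ((n : ℝ) + 1), one_div_succ_mem_unitInterval n⟩) 0 (fun _ => I) I
    (tendsto_subtype_rng.2 tendsto_one_div_add_atTop_nhds_zero_nat) tendsto_const_nhds
    (fun _ => by simp) (by simp) ?_ unitSquareQuad unitSquareQuad φ₀ x₀
    (moduliShear_I_image _).symm (fun i => (moduliShear_I_apply _).symm) hux₀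
  · simp only [↓reduceIte] at key
    have h2 := tendsto_nhds_unique key tendsto_const_nhds
    rw [crossRatio_unitSquareQuad hux₀, cardyFunction_half] at h2
    norm_num at h2
  · intro n R R' φ x hc hp hux
    rw [moduliShear_I_image] at hc
    simp only [moduliShear_I_apply] at hp
    simp only [hne n, ↓reduceIte]
    rw [crossRatio_eq_modulus_of_carrier_eq hc hp hux]
    exact tendsto_const_nhds

/-- **`stub_identification` WITHOUT `t n → t₀` is FALSE** (UM kept). Witness: `t ≡ 1`, `t₀ = 0`,
`α ≡ i`, `P s R δ = 2` for `s < 1/2` (so UM holds at `0` trivially) and `P s R δ = F(η(R))` for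
`s ≥ 1/2`. [folklore] -/
theorem stub_identification_false_without_tendsto :
    ¬ ∀ (P : unitInterval → ConformalRectangle → ℝ → ℝ) (t : ℕ → unitInterval) (t₀ : unitInterval)
        (α : ℕ → ℂ) (α₀ : ℂ),
        Tendsto α atTop (𝓝 α₀) → (∀ n, 0 < (α n).im) → 0 < α₀.im →
        (∀ (R : ConformalRectangle) (ε : ℝ), 0 < ε → ∃ η > 0, ∀ s : unitInterval,
          dist s t₀ < η → ∀ δ : ℝ, 0 < δ → |P s R δ - P t₀ R δ| < ε) →
        (∀ n (R R' : ConformalRectangle) (φ : ConformalEquiv upperHalfPlaneSet R.carrier)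
          (x : Fin 4 → ℝ), R.carrier = moduliShear (α n) '' R'.carrier →
          (∀ i, R.pt i = moduliShear (α n) (R'.pt i)) → R.IsUniformizing φ x →
          Tendsto (P (t n) R') (𝓝[>] 0) (𝓝 (cardyFunction (crossRatio x)))) →
        ∀ (R R' : ConformalRectangle) (φ : ConformalEquiv upperHalfPlaneSet R.carrier)
          (x : Fin 4 → ℝ), R.carrier = moduliShear α₀ '' R'.carrier →
          (∀ i, R.pt i = moduliShear α₀ (R'.pt i)) → R.IsUniformizing φ x →
          Tendsto (P t₀ R') (𝓝[>] 0) (𝓝 (cardyFunction (crossRatio x))) := by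
  intro H
  obtain ⟨φ₀, x₀, hux₀⟩ := MarkedDomain.exists_isUniformizing_holds unitSquareQuad
  have key := H (fun s R _ => if (s : ℝ) < 1 / 2 then 2 else cardyFunction (modulus R))
    (fun _ => 1) 0 (fun _ => I) I tendsto_const_nhds (fun _ => by simp) (by simp) ?_ ?_
    unitSquareQuad unitSquareQuad φ₀ x₀
    (moduliShear_I_image _).symm (fun i => (moduliShear_I_apply _).symm) hux₀
  · have h0 : ((0 : unitInterval) : ℝ) < 1 / 2 := by simp
    simp only [h0, ↓reduceIte] at key
    have h2 := tendsto_nhds_unique key tendsto_const_nhds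
    rw [crossRatio_unitSquareQuad hux₀, cardyFunction_half] at h2
    norm_num at h2
  · -- UM at `t₀ = 0`: `P` is constant (`= 2`) on `{s < 1/2}`
    intro R ε hε
    refine ⟨1 / 2, by norm_num, fun s hs δ _ => ?_⟩
    have hs' : (s : ℝ) < 1 / 2 := by
      rw [Subtype.dist_eq, Real.dist_eq, Set.Icc.coe_zero, sub_zero] at hs
      exact lt_of_abs_lt hs
    have h0 : ((0 : unitInterval) : ℝ) < 1 / 2 := by simp
    simp only [hs', h0, ↓reduceIte, sub_self, abs_zero]
    exact hε
  · intro n R R' φ x hc hp hux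
    rw [moduliShear_I_image] at hc
    simp only [moduliShear_I_apply] at hp
    have h1 : ¬ ((1 : unitInterval) : ℝ) < 1 / 2 := by simp; norm_num
    simp only [h1, ↓reduceIte]
    rw [crossRatio_eq_modulus_of_carrier_eq hc hp hux]
    exact tendsto_const_nhds

/-- **`stub_identification` WITHOUT the Cardy hypothesis along the sequence is FALSE** (trivially:
`P ≡ 2` is equicontinuous and converges nowhere to a Cardy value). [folklore] -/
theorem stub_identification_false_without_hmod :
    ¬ ∀ (P : unitInterval → ConformalRectangle → ℝ → ℝ) (t : ℕ → unitInterval) (t₀ : unitInterval)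
        (α : ℕ → ℂ) (α₀ : ℂ),
        Tendsto t atTop (𝓝 t₀) → Tendsto α atTop (𝓝 α₀) → (∀ n, 0 < (α n).im) → 0 < α₀.im →
        (∀ (R : ConformalRectangle) (ε : ℝ), 0 < ε → ∃ η > 0, ∀ s : unitInterval,
          dist s t₀ < η → ∀ δ : ℝ, 0 < δ → |P s R δ - P t₀ R δ| < ε) →
        ∀ (R R' : ConformalRectangle) (φ : ConformalEquiv upperHalfPlaneSet R.carrier)
          (x : Fin 4 → ℝ), R.carrier = moduliShear α₀ '' R'.carrier →
          (∀ i, R.pt i = moduliShear α₀ (R'.pt i)) → R.IsUniformizing φ x →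
          Tendsto (P t₀ R') (𝓝[>] 0) (𝓝 (cardyFunction (crossRatio x))) := by
  intro H
  obtain ⟨φ₀, x₀, hux₀⟩ := MarkedDomain.exists_isUniformizing_holds unitSquareQuad
  have key := H (fun _ _ _ => 2) (fun _ => 0) 0 (fun _ => I) I tendsto_const_nhds tendsto_const_nhds
    (fun _ => by simp) (by simp)
    (fun R ε hε => ⟨1, one_pos, fun s _ δ _ => by simpa using hε⟩)
    unitSquareQuad unitSquareQuad φ₀ x₀
    (moduliShear_I_image _).symm (fun i => (moduliShear_I_apply _).symm) hux₀
  have h2 := tendsto_nhds_unique key tendsto_const_nhds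
  rw [crossRatio_unitSquareQuad hux₀, cardyFunction_half] at h2
  norm_num at h2

/-! ## §3 … whereas `0 < im α₀` is not needed for truth (vacuity at real moduli) -/

/-- For a REAL shear parameter the shear collapses the plane onto the real axis. [folklore] -/
theorem moduliShear_im_of_im_eq_zero {α₀ : ℂ} (h : α₀.im = 0) (z : ℂ) : (moduliShear α₀ z).im = 0 := by
  simp [moduliShear, h]

/-- **`CardyMod t₀ α₀` is vacuously TRUE for real `α₀`** (for every family `P`): no conformal
rectangle has its (open, nonempty) carrier inside `φ_{α₀}(ℂ) ⊆ ℝ`. So the hypothesis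
`hα₀ : 0 < im α₀` of `stub_identification` (and `hαn`, which moreover follows eventually from
`α n → α₀ ∈ ℍ`) is not load-bearing for the truth of the stub — only for its use. [folklore] -/
theorem cardyMod_of_im_eq_zero {α₀ : ℂ} (h : α₀.im = 0)
    (P : unitInterval → ConformalRectangle → ℝ → ℝ) (t₀ : unitInterval)
    (R R' : ConformalRectangle) (φ : ConformalEquiv upperHalfPlaneSet R.carrier) (x : Fin 4 → ℝ)
    (hc : R.carrier = moduliShear α₀ '' R'.carrier) (_hp : ∀ i, R.pt i = moduliShear α₀ (R'.pt i))
    (_hu : R.IsUniformizing φ x) :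
    Tendsto (P t₀ R') (𝓝[>] 0) (𝓝 (cardyFunction (crossRatio x))) := by
  exfalso
  obtain ⟨z, hz⟩ := R.isConnected.nonempty
  obtain ⟨r, hr, hball⟩ := Metric.isOpen_iff.1 R.isOpen z hz
  have hmem : z + ((r / 2 : ℝ) : ℂ) * I ∈ R.carrier := by
    apply hball
    rw [Metric.mem_ball, dist_eq_norm, add_sub_cancel_left, norm_mul, Complex.norm_I, mul_one,
      Complex.norm_real, Real.norm_eq_abs, abs_of_pos (by positivity)]
    linarith
  have him : ∀ w ∈ R.carrier, w.im = 0 := by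
    intro w hw
    rw [hc] at hw
    obtain ⟨v, -, rfl⟩ := hw
    exact moduliShear_im_of_im_eq_zero h v
  have h1 := him _ hz
  have h2 := him _ hmem
  simp [h1] at h2
  exact hr.ne' h2

end Summit.CriticalPhenomena.CardyFormulaZ2.Theorems.SegmentClosed.Negative

end
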